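import Literature.AlgebraicGeometry.HodgeTheory.WeilClassesDescendingOfLefschetzOneOne
import Literature.AlgebraicGeometry.HodgeTheory.ComplexConjugation
import Literature.AlgebraicTopology.SingularHomology.CupProductProofs
import HarnessLib

/-!
# A non-zero REAL Weil class has non-zero self-cup: `w ⌣ w ≠ 0` (the rational Weil plane is cup-anisotropic)

Family `hodge`, layer `Literature/AlgebraicGeometry/HodgeTheory`. PROVED on the tree's real carriers; no
definition, no named fact. Companion of `WeilClassesPolarizationOrthogonal.lean` (`h ⌣ w = 0` for `K`-symmetric
`h`); requested by the B2b ladder `hodge-weil` (packet `run/shared/lean/b2b/hodge-weil/`, prover 2 generation 4,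
`b2b-hweil-pv2-g4/BLOCH-SEEDS.md` §2 (b): the step "`w ≠ 0 ⟹ w² ≠ 0`" of the single-sub-torus exclusion, and
the carver's CM-square datum `w₊² = -128 d³ ≠ 0`, `LADDER.md ## CARVER v5` C36).

## Statement and proof

Let `A` be a complex abelian `2n`-fold (`A.dim = 2n`, `n ≥ 1`), `φ ≫ φ = -(d • 𝟙 A)`, `d ≥ 1`, and `w` a class of the
Weil plane `weilClassesOf A φ n d = E₊ ⊔ E₋ ⊆ H^{2n}(A(ℂ); ℂ)` which is REAL — fixed by complex conjugation of
coefficients, `conjClass w = w` (every rational class is: `IsRationalClass.conjClass_eq`). If `w ≠ 0` then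
`w ⌣ w ≠ 0` in `H^{4n}(A(ℂ); ℂ)`.

Proof. Write `w = y + z`, `y ∈ E₊`, `z ∈ E₋` (`Submodule.mem_sup`). Conjugation swaps the two Weil lines
(`conjClass_mem_weilClassesMinus/Plus`), so `w = conj w = conj y + conj z` with `conj z ∈ E₊`, `conj y ∈ E₋`, and
`E₊ ∩ E₋ = 0` (`disjoint_weilClassesPlus_weilClassesMinus`) forces `z = conj y`; hence `y ≠ 0` (else `w = 0`) and
`z ≠ 0` (`conjClass_ne_zero`). Then `w ⌣ w = y ⌣ y + y ⌣ z + z ⌣ y + z ⌣ z = 2·(y ⌣ z)`: `E± ⌣ E± = 0`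
(`cupProduct_self_eq_zero_of_mem_weilClassesPlus/Minus`), `z ⌣ y = y ⌣ z` (graded commutativity in even degree,
`cupProduct_gradedComm_holds`), and `y ⌣ z ≠ 0` (`cupProduct_ne_zero_of_mem_weilClassesPlus_of_mem_weilClassesMinus`:
`⋀²ⁿV₊ ∧ ⋀²ⁿV₋ = ⋀⁴ⁿH¹ ≠ 0`); `2 ≠ 0` in `ℂ`. This is the exterior-algebra form of the statement; the
Hodge–Riemann form (`(-1)ⁿ ∫ w_σ w̄_σ > 0`, van Geemen 5.2 / Deligne 4.4) is not needed.

## References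

* [vanGeemen1994HodgeAV] B. van Geemen, LNM 1594 (1994): 4.9, proof of Lemma 5.2 (6), proof of Thm. 6.12.
* [Schoen1998HodgeWeilAddendum] C. Schoen, Compositio Math. 114 (1998), §10 (the perfect pairing of the Weil lines).
* [VoisinHodgeI2002] C. Voisin, Hodge Theory and Complex Algebraic Geometry I, Cor. 6.12 (rational classes are real).
* [Hatcher2002] A. Hatcher, Algebraic Topology, Thm. 3.11 (graded commutativity).
-/

noncomputable section

open CategoryTheory

namespace Literature.AlgebraicGeometry.HodgeTheory

open Literature.AlgebraicTopology.SingularHomology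

section HodgeTheory

variable {A : Motives.AbelianVariety ℂ}

/-- **In a real Weil class the two Weil-line components are conjugate.** If `w = y + z` with `y ∈ E₊`, `z ∈ E₋`
(`n, d ≥ 1`) and `conjClass w = w`, then `z = conjClass y`. (Conjugation swaps `E₊` and `E₋`, which meet in `0`.)
[cite: vanGeemen1994HodgeAV, proof of Lemma 5.2 (6)] [cite: VoisinHodgeI2002, Cor. 6.12] -/
theorem eq_conjClass_of_add_mem_weilClasses_of_conjClass_eq {n d : ℕ} (hn : 0 < n) (hd : 0 < d) {φ : A ⟶ A}
    {y z : complexBetti A.X (2 * n)} (hy : y ∈ weilClassesPlus A φ n d) (hz : z ∈ weilClassesMinus A φ n d)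
    (hreal : conjClass (Motives.ComplexPoints A.X) (2 * n) (y + z) = y + z) :
    z = conjClass (Motives.ComplexPoints A.X) (2 * n) y := by
  have hcy : conjClass (Motives.ComplexPoints A.X) (2 * n) y ∈ weilClassesMinus A φ n d :=
    conjClass_mem_weilClassesMinus hy
  have hcz : conjClass (Motives.ComplexPoints A.X) (2 * n) z ∈ weilClassesPlus A φ n d :=
    conjClass_mem_weilClassesPlus hz
  rw [conjClass_add] at hreal
  -- `y - conj z = conj y - z` lies in `E₊ ∩ E₋ = 0`
  have hdiff : y - conjClass (Motives.ComplexPoints A.X) (2 * n) z =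
      conjClass (Motives.ComplexPoints A.X) (2 * n) y - z := by
    rw [sub_eq_sub_iff_add_eq_add]
    exact hreal.symm
  have hplus : y - conjClass (Motives.ComplexPoints A.X) (2 * n) z ∈ weilClassesPlus A φ n d :=
    Submodule.sub_mem _ hy hcz
  have hminus : y - conjClass (Motives.ComplexPoints A.X) (2 * n) z ∈ weilClassesMinus A φ n d := by
    rw [hdiff]; exact Submodule.sub_mem _ hcy hz
  have h0 : y - conjClass (Motives.ComplexPoints A.X) (2 * n) z = 0 :=
    (Submodule.disjoint_def.mp (disjoint_weilClassesPlus_weilClassesMinus A φ hn hd)) _ hplus hminus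
  rw [h0, eq_comm, sub_eq_zero] at hdiff
  exact hdiff.symm

/-- **A non-zero real Weil class has non-zero self-cup** (`A.dim = 2n`, `n, d ≥ 1`, `φ ≫ φ = -(d • 𝟙 A)`,
`w ∈ weilClassesOf A φ n d`, `conjClass w = w`, `w ≠ 0` ⟹ `w ⌣ w ≠ 0` in any target degree `k = 2n + 2n`): with
`w = y + ȳ`, `y ∈ E₊ ∖ 0`, one has `w ⌣ w = 2·(y ⌣ ȳ) ≠ 0` (`E± ⌣ E± = 0`, `E₊ ⌣ E₋ = ⋀⁴ⁿH¹ ≠ 0`, graded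
commutativity in even degrees). In particular the RATIONAL Weil plane is anisotropic for the cup pairing.
[cite: vanGeemen1994HodgeAV, proof of Lemma 5.2 (6) and of Thm. 6.12]
[cite: Schoen1998HodgeWeilAddendum, §10 (proof of the Proposition, p. 333)] [cite: Hatcher2002, Thm. 3.11] -/
theorem cupProduct_self_ne_zero_of_conjClass_eq_of_mem_weilClassesOf {n d : ℕ} (hA : A.dim = 2 * n) (hn : 0 < n)
    (hd : 0 < d) {φ : A ⟶ A} (hφ : φ ≫ φ = -(d • 𝟙 A)) {w : complexBetti A.X (2 * n)}
    (hw : w ∈ weilClassesOf A φ n d) (hreal : conjClass (Motives.ComplexPoints A.X) (2 * n) w = w) (hw0 : w ≠ 0)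
    {k : ℕ} (hk : 2 * n + 2 * n = k) : cupProduct hk w w ≠ 0 := by
  subst hk
  have hb₁ : Module.finrank ℂ (complexBetti A.X 1) = 2 * (2 * n) := by
    rw [Motives.AbelianVariety.finrank_complexBetti_one, hA]
  obtain ⟨y, hy, z, hz, rfl⟩ := Submodule.mem_sup.mp hw
  have hzy : z = conjClass (Motives.ComplexPoints A.X) (2 * n) y :=
    eq_conjClass_of_add_mem_weilClasses_of_conjClass_eq hn hd hy hz hreal
  have hy0 : y ≠ 0 := by
    intro h0
    apply hw0
    rw [hzy, h0, conjClass_zero, add_zero]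
  have hz0 : z ≠ 0 := by rw [hzy]; exact conjClass_ne_zero hy0
  -- expand `(y + z) ⌣ (y + z)`
  have hyy : cupProduct rfl y y = 0 := cupProduct_self_eq_zero_of_mem_weilClassesPlus hb₁ hn hd hφ rfl hy
  have hzz : cupProduct rfl z z = 0 := cupProduct_self_eq_zero_of_mem_weilClassesMinus hb₁ hn hd hφ rfl hz
  have hyz : cupProduct rfl y z ≠ 0 :=
    cupProduct_ne_zero_of_mem_weilClassesPlus_of_mem_weilClassesMinus hb₁ hn hd hφ rfl hy hz hy0 hz0
  have hzy' : cupProduct (rfl : 2 * n + 2 * n = 2 * n + 2 * n) z y = cupProduct rfl y z := by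
    rw [cupProduct_gradedComm_holds ℂ (Motives.ComplexPoints A.X) rfl rfl z y,
      Even.neg_one_pow (by rw [Nat.even_mul]; exact Or.inl ⟨n, two_mul n⟩), one_smul]
  have e : cupProduct (rfl : 2 * n + 2 * n = 2 * n + 2 * n) (y + z) (y + z) =
      cupProduct rfl y z + cupProduct rfl y z := by
    simp only [map_add, LinearMap.add_apply, hyy, hzz, hzy', zero_add, add_zero]
  have e2 : cupProduct (rfl : 2 * n + 2 * n = 2 * n + 2 * n) y z + cupProduct rfl y z =
      (2 : ℂ) • cupProduct rfl y z := (two_smul ℂ _).symm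
  rw [e, e2]
  exact smul_ne_zero two_ne_zero hyz

/-- **A non-zero RATIONAL Weil class has non-zero self-cup** (rational classes are real,
`IsRationalClass.conjClass_eq`). [cite: vanGeemen1994HodgeAV, 4.9 and proof of Lemma 5.2 (6)]
[cite: VoisinHodgeI2002, Cor. 6.12] -/
theorem cupProduct_self_ne_zero_of_isRationalClass_of_mem_weilClassesOf {n d : ℕ} (hA : A.dim = 2 * n) (hn : 0 < n)
    (hd : 0 < d) {φ : A ⟶ A} (hφ : φ ≫ φ = -(d • 𝟙 A)) {w : complexBetti A.X (2 * n)}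
    (hw : w ∈ weilClassesOf A φ n d) (hrat : IsRationalClass w) (hw0 : w ≠ 0) {k : ℕ} (hk : 2 * n + 2 * n = k) :
    cupProduct hk w w ≠ 0 :=
  cupProduct_self_ne_zero_of_conjClass_eq_of_mem_weilClassesOf hA hn hd hφ hw hrat.conjClass_eq hw0 hk

end HodgeTheory

end Literature.AlgebraicGeometry.HodgeTheory

end
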